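import Literature.MathematicalPhysics.QuantumFieldTheory.ConformalBootstrap3D.PointKernelK57Data

/-!
# K57 certificate, kernel block file H6: head segments `35 ≤ i < 41` (block-checked ones)

`decide` by kernel reduction (no `native_decide`, no extra axioms) of the block checker
`PCert.hBlockOK` of `PointKernel` on the literal data of `PointKernelK57Data` (cells checked corner
or chord by the rule bit); soundness is `PCert.hBlockOK_sound`.  Estimated kernel time 160 s
(3 theorems).
-/

set_option maxRecDepth 100000
set_option maxHeartbeats 0

namespace Literature.MathematicalPhysics.QuantumFieldTheory.ConformalBootstrap3D.PointKernelK57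

open Literature.MathematicalPhysics.QuantumFieldTheory.ConformalBootstrap3D.PointKernel

/-- head segments `[35, 37)` pass the kernel evaluator (≈52 s of kernel work). [folklore] -/
theorem hBlock_35 : certK57.hBlockOK hsegsK57 35 37 JHK57 = true := by
  decide +kernel

/-- head segments `[37, 39)` pass the kernel evaluator (≈50 s of kernel work). [folklore] -/
theorem hBlock_37 : certK57.hBlockOK hsegsK57 37 39 JHK57 = true := by
  decide +kernel

/-- head segments `[39, 41)` pass the kernel evaluator (≈50 s of kernel work). [folklore] -/
theorem hBlock_39 : certK57.hBlockOK hsegsK57 39 41 JHK57 = true := by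
  decide +kernel

end Literature.MathematicalPhysics.QuantumFieldTheory.ConformalBootstrap3D.PointKernelK57
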